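import Summits.MatrixMultiplication.MatrixMultiplication.Theorems.TetraUniversalRestriction
import Summits.MatrixMultiplication.MatrixMultiplication.Theorems.EdgePencilPlusTwoCut
import Literature.Computability.AlgebraicComplexity.TensorRestrictionRank
import Literature.Computability.AlgebraicComplexity.RectangularExponentAsymptoticRank
import Literature.Computability.AlgebraicComplexity.RectangularExponentSymmetry
import Literature.Computability.AlgebraicComplexity.PrattTripartitionBoundsProofs
import HarnessLib

/-!
# Tetrahedron tensor — the collapse window is CLOSED: `collapseExponents = (-∞, ω(1,2,2)]`

Decomp-mm lens 6, g30 (the writer's tasks t1/t2 = the critic's SHARPEN s1/s2 on g29), on **door D2** of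
`TetraUniversalRestriction.lean`: the one-leg collapses `⟨n,n,n⟩ ⊠ W ≤ T(K₄)_n` for a FREE weight
`W : [n] × [n] × ([n] × Z)`, their exponent set `collapseExponents F`, and the g29 implication
`tetraPlusTwo_of_collapseSaturation : (collapse saturation) → TetraPlusTwo` (item 27058, the declared
residual of the cut of record `closes (TetraExcessZero) (TetraPlusTwo) : ω = 2`, UNCHANGED here).

**The identity weight is universal (§1).** Every weight `W : [n] × [n] × M` — ANY third index type `M` —
is a RESTRICTION of the identity weight `𝟙_n = ⟨1,n,n⟩` (unit slots removed:
`𝟙_n x y (c₁,c₂) = [y = c₁][x = c₂]`, the 3-tensor supported on `{(x, y, (y, x))}`): take `A = B = id`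
and `C c' (c₁,c₂) = W c₂ c₁ c'` (`oneWeight_restrictsTo`).  Restriction is compatible with `⊠` and
monotone for rank (Bläser 2013, Lemma 5.4; BCS (15.25)), so for EVERY weight

  `R(⟨n,n,n⟩ ⊠ W) ≤ R(⟨n,n,n⟩ ⊠ 𝟙_n) = R(⟨n·1, n·n, n·n⟩)`   (`tensorRank_kronecker_le_rect`),

with equality at (the zero-padding of) `𝟙_n` (`tensorRank_kronecker_padWeight`, §2): the supremum over
weights that door D2 asked to saturate is ATTAINED by the grouping certificate `⟨n, n², n²⟩ ≤ T(K₄)_n`.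

**The window in exponents (§3, t1).** `4 ∈ collapseExponents F` (flattening, `n⁴ ≤ R(⟨n,n²,n²⟩)`),
`ω(1,2,2) ∈ collapseExponents F` (`q^{ω(1,2,2)} ≤ R̃(⟨q,q²,q²⟩) ≤ R(⟨q,q²,q²⟩)`, ADVXXZ 2025 §3.4), and by
universality every certified exponent is `≤ ω(1,2,2)`; altogether

  `collapseExponents F = Set.Iic (ω(1,2,2)) = Set.Iic (ω(2,1,2))`   (`collapseExponents_eq_Iic`).

**Door D2 is the summit in costume (§3–§4, t2 and more).** Collapse saturation
`∀ ε > 0, ∃ β ∈ collapseExponents F, ω + 2 − ε ≤ β` is therefore equivalent to `ω + 2 ≤ ω(2,1,2)`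
(`collapseSaturation_iff`), and by the recorded chord `ω(2,1,2) − 4 ≤ κ(0.1722)·(ω − 2)`,
`κ(0.1722) < 0.792 < 1` (Lotti–Romani convexity + Coppersmith 1982; `EdgePencilDefectCone`,
`EdgePencilPlusTwoCut`) to `ω = 2` over every field (`collapseSaturation_iff_omega_eq_two`); over `ℂ`
`collapseSaturation_iff_matrixMultiplication`, `S ⟹ h` by name (`collapseSaturation_of_matrixMultiplication`),
and `h ⟺ TetraExcessZero ∧ TetraPlusTwo` (the WHOLE cut, not the residual).  So the g29 door
`h → TetraPlusTwo` is `S → TetraPlusTwo` precomposed with `h ↔ S`: it cannot certify item 27058 short of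
the summit, and the complement-census row «free-weight one-leg collapses» closes with value exactly
`ω(2,1,2)` — the same ceiling as the grouping / flattening certificates (`TetraResidualGroupingCeiling`).
The residual `TetraPlusTwo` itself is untouched (NEC for `ω = 2`, not known to imply it).

References: Bläser 2013, Lemma 5.4 / 5.8, §5.2 p. 24, Lemma 7.1; Bürgisser–Clausen–Shokrollahi 1997,
(15.25); Alman–Duan–Vassilevska Williams–Xu–Xu–Zhou 2025, §3.4; Lotti–Romani 1983, §3; Coppersmith 1982,
Thm. 1. [Blaser2013] [BurgisserClausenShokrollahi1997] [AlmanDuanVassilevskaWilliamsXuXuZhou2025]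
[LottiRomani1983] [Coppersmith1982]

Sorry-free; one explicit restriction, index bookkeeping, and linear arithmetic on recorded exponent
inequalities.
-/

noncomputable section

set_option linter.dupNamespace false

namespace Summit.MatrixMultiplication.MatrixMultiplication.Theorems.TetrahedronTensor

open Literature.Computability.AlgebraicComplexity

/-! ## §1 The identity weight `𝟙_n = ⟨1,n,n⟩` is universal among weights -/

section Universal

variable {F : Type*} [Field F]

/-- **The identity weight** `𝟙_n : [n] × [n] × ([n] × [n])`: the matrix multiplication tensor `⟨1,n,n⟩`
with its two unit slots removed along `Fin 1 × Fin n ≃ Fin n`; entries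
`𝟙_n x y (c₁, c₂) = [y = c₁ ∧ x = c₂]`. [cite: Blaser2013, §5 (the tensor ⟨k,m,n⟩)] -/
def oneWeight (n : ℕ) : Fin n → Fin n → Fin n × Fin n → F :=
  fun x y c => matMulTensor F 1 n n ((Equiv.uniqueProd (Fin n) (Fin 1)).symm x)
    ((Equiv.uniqueProd (Fin n) (Fin 1)).symm y) c

/-- Entries of the identity weight: `𝟙_n x y c = [y = c.1 ∧ x = c.2]`. [folklore] -/
theorem oneWeight_apply (n : ℕ) (x y : Fin n) (c : Fin n × Fin n) :
    oneWeight (F := F) n x y c = if y = c.1 ∧ x = c.2 then 1 else 0 := by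
  simp [oneWeight, matMulTensor]

/-- **`⟨n,n,n⟩ ⊠ 𝟙_n ≅ ⟨n·1, n·n, n·n⟩`** as an equality of ranks: restore the two unit slots, then
"matrix tensors multiply" (Bläser 2013, p. 24). [cite: Blaser2013, §5.2 p. 24] -/
theorem tensorRank_kronecker_oneWeight (n : ℕ) :
    tensorRank (kroneckerTensor (matMulTensor F n n n) (oneWeight (F := F) n)) =
      tensorRank (matMulTensor F (n * 1) (n * n) (n * n)) := by
  rw [← tensorRank_kroneckerTensor_matMulTensor n n n 1 n n,
    ← tensorRank_reindex ((Equiv.refl (Fin n × Fin n)).prodCongr (Equiv.uniqueProd (Fin n) (Fin 1)))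
      ((Equiv.refl (Fin n × Fin n)).prodCongr (Equiv.uniqueProd (Fin n) (Fin 1)))
      (Equiv.refl ((Fin n × Fin n) × (Fin n × Fin n)))
      (kroneckerTensor (matMulTensor F n n n) (oneWeight (F := F) n))]
  congr 1
  funext a b c
  simp only [kroneckerTensor_apply, Equiv.prodCongr_apply, Prod.map_fst, Prod.map_snd,
    Equiv.coe_refl, id_eq, oneWeight, Equiv.symm_apply_apply]

/-- **Every weight is a restriction of the identity weight**: `𝟙_n ≥ W` for every `W : [n] × [n] × M`
(any index type `M`), via `A = B = id` and `C c' (c₁, c₂) = W c₂ c₁ c'`.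
[cite: Blaser2013, Lemma 5.4] -/
theorem oneWeight_restrictsTo {n : ℕ} {M : Type*} (W : Fin n → Fin n → M → F) :
    TensorRestrictsTo (oneWeight (F := F) n) W := by
  classical
  refine ⟨fun a' a => if a' = a then 1 else 0, fun b' b => if b' = b then 1 else 0,
    fun c' c => W c.2 c.1 c', fun a' b' c' => ?_⟩
  rw [Finset.sum_eq_single a' (fun a _ ha => by simp [Ne.symm ha]) (by simp),
    Finset.sum_eq_single b' (fun b _ hb => by simp [Ne.symm hb]) (by simp),
    Finset.sum_eq_single (b', a') (fun c _ hc => ?_) (by simp)]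
  · simp [oneWeight_apply]
  · have h : ¬(b' = c.1 ∧ a' = c.2) := fun h => hc (Prod.ext h.1.symm h.2.symm)
    rw [oneWeight_apply, if_neg h, mul_zero]

/-- **Universality of the identity weight for one-leg collapses**:
`R(⟨n,n,n⟩ ⊠ W) ≤ R(⟨n,n,n⟩ ⊠ 𝟙_n)` for every weight `W`. [cite: Blaser2013, Lemma 5.4] -/
theorem tensorRank_kronecker_le_kronecker_oneWeight (n : ℕ) {M : Type*}
    (W : Fin n → Fin n → M → F) :
    tensorRank (kroneckerTensor (matMulTensor F n n n) W) ≤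
      tensorRank (kroneckerTensor (matMulTensor F n n n) (oneWeight (F := F) n)) := by
  classical
  exact ((TensorRestrictsTo.refl (matMulTensor F n n n)).kronecker
    (oneWeight_restrictsTo W)).tensorRank_le

/-- **The free-weight supremum IS the grouping certificate**: `R(⟨n,n,n⟩ ⊠ W) ≤ R(⟨n·1, n·n, n·n⟩)`
for EVERY weight `W : [n] × [n] × M`. [cite: Blaser2013, Lemma 5.4 and §5.2 p. 24] -/
theorem tensorRank_kronecker_le_rect (n : ℕ) {M : Type*} (W : Fin n → Fin n → M → F) :
    tensorRank (kroneckerTensor (matMulTensor F n n n) W) ≤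
      tensorRank (matMulTensor F (n * 1) (n * n) (n * n)) :=
  (tensorRank_kronecker_le_kronecker_oneWeight n W).trans (tensorRank_kronecker_oneWeight n).le

/-- The same bound in the honest format `⟨n, n², n²⟩`. [cite: Blaser2013, Lemma 5.4 and §5.2 p. 24] -/
theorem tensorRank_kronecker_le_rect' (n : ℕ) {M : Type*} (W : Fin n → Fin n → M → F) :
    tensorRank (kroneckerTensor (matMulTensor F n n n) W) ≤
      tensorRank (matMulTensor F n (n ^ 2) (n ^ 2)) :=
  (tensorRank_kronecker_le_rect n W).trans
    (tensorRank_matMulTensor_congr F (mul_one n) (sq n).symm (sq n).symm).le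

/-! ## §2 The bound is attained: the padded identity weight -/

/-- The identity weight padded by zeros to the image index set `[n] × [n³]` of `collapseExponents`
(`n ≤ n³`): `pad 𝟙_n x y (c₁, c₂) = [y = c₁ ∧ x = c₂ (as naturals)]`. [folklore] -/
def padWeight (n : ℕ) : Fin n → Fin n → Fin n × Fin (n ^ 3) → F :=
  fun x y c => if y = c.1 ∧ (x : ℕ) = (c.2 : ℕ) then 1 else 0

/-- Restricting the padded weight's image index back along `[n] ↪ [n³]` recovers `⟨n,n,n⟩ ⊠ 𝟙_n`.
[folklore] -/
theorem kronecker_padWeight_precomp (n : ℕ) :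
    (fun a b (c : (Fin n × Fin n) × (Fin n × Fin n)) =>
        kroneckerTensor (matMulTensor F n n n) (padWeight (F := F) n) a b
          (c.1, (c.2.1, Fin.castLE (Nat.le_self_pow three_ne_zero n) c.2.2))) =
      kroneckerTensor (matMulTensor F n n n) (oneWeight (F := F) n) := by
  funext a b c
  simp only [kroneckerTensor_apply, padWeight, oneWeight_apply, Fin.val_castLE, Fin.val_inj]

/-- **The padded identity weight attains the universal bound**:
`R(⟨n,n,n⟩ ⊠ pad 𝟙_n) = R(⟨n·1, n·n, n·n⟩)`. [cite: Blaser2013, Lemma 5.4 and §5.2 p. 24] -/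
theorem tensorRank_kronecker_padWeight (n : ℕ) :
    tensorRank (kroneckerTensor (matMulTensor F n n n) (padWeight (F := F) n)) =
      tensorRank (matMulTensor F (n * 1) (n * n) (n * n)) := by
  refine le_antisymm (tensorRank_kronecker_le_rect n _) ?_
  rw [← tensorRank_kronecker_oneWeight (F := F) n, ← kronecker_padWeight_precomp (F := F) n]
  exact tensorRank_precomp_le (kroneckerTensor (matMulTensor F n n n) (padWeight (F := F) n))
    (fun a => a) (fun b => b)
    (fun c : (Fin n × Fin n) × (Fin n × Fin n) =>
      (c.1, (c.2.1, Fin.castLE (Nat.le_self_pow three_ne_zero n) c.2.2)))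

/-- **Flattening floor**: `n⁴ ≤ R(⟨n,n,n⟩ ⊠ pad 𝟙_n)` (`(n·n)(n·n) ≤ R(⟨n·1, n·n, n·n⟩)`).
[cite: Blaser2013, Lemma 7.1 (2)] -/
theorem pow_four_le_tensorRank_kronecker_padWeight (n : ℕ) :
    n ^ 4 ≤ tensorRank (kroneckerTensor (matMulTensor F n n n) (padWeight (F := F) n)) := by
  rcases Nat.eq_zero_or_pos n with rfl | hn
  · simp
  haveI : NeZero (n * 1) := ⟨by simpa using hn.ne'⟩
  rw [tensorRank_kronecker_padWeight]
  calc n ^ 4 = n * n * (n * n) := by ring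
    _ ≤ _ := mul_le_tensorRank_matMulTensor_right F (n * 1) (n * n) (n * n)

end Universal

/-- **Rectangular floor**: `n^{ω(1,2,2)} ≤ R(⟨n,n,n⟩ ⊠ pad 𝟙_n)` for `n ≥ 2`
(`q^{ω(a,b,c)} ≤ R̃(⟨q^a,q^b,q^c⟩) ≤ R(⟨q^a,q^b,q^c⟩)`, ADVXXZ 2025 §3.4).
[cite: AlmanDuanVassilevskaWilliamsXuXuZhou2025, §3.4] -/
theorem rpow_omegaRect_le_tensorRank_kronecker_padWeight (F : Type) [Field F] {n : ℕ} (hn : 2 ≤ n) :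
    (n : ℝ) ^ omegaRect F 1 2 2 ≤
      (tensorRank (kroneckerTensor (matMulTensor F n n n) (padWeight (F := F) n)) : ℝ) := by
  have h := rpow_omegaRect_le_asymptoticRank_matMulTensor F hn 1 2 2
  simp only [Nat.cast_one, Nat.cast_ofNat] at h
  refine h.trans ((asymptoticRank_le_tensorRank _).trans (le_of_eq ?_))
  rw [tensorRank_kronecker_padWeight]
  exact_mod_cast tensorRank_matMulTensor_congr F ((pow_one n).trans (mul_one n).symm) (sq n) (sq n)

/-! ## §3 The collapse window in exponents: `collapseExponents F = (-∞, ω(1,2,2)]` -/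

section Exponent

variable (F : Type) [Field F]

open Filter Asymptotics

/-- **`4` is collapse-certified** (t1): `n⁴ ≤ R(⟨n,n,n⟩ ⊠ pad 𝟙_n)` by flattening.
[cite: Blaser2013, Lemma 7.1 (2)] -/
theorem four_mem_collapseExponents : (4 : ℝ) ∈ collapseExponents F := by
  refine ⟨fun n => padWeight n, IsBigO.of_bound 1 (Eventually.of_forall fun n => ?_)⟩
  rw [one_mul, Real.norm_of_nonneg (Real.rpow_nonneg (Nat.cast_nonneg _) _),
    Real.norm_of_nonneg (Nat.cast_nonneg _), show (4 : ℝ) = ((4 : ℕ) : ℝ) by norm_num,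
    Real.rpow_natCast]
  exact_mod_cast pow_four_le_tensorRank_kronecker_padWeight (F := F) n

/-- **`ω(1,2,2)` is collapse-certified** (t1): the grouping certificate, as ONE collapse with the
(padded) identity weight, certifies `ω(1,2,2) = ω(2,1,2)` on the nose.
[cite: AlmanDuanVassilevskaWilliamsXuXuZhou2025, §3.4] -/
theorem omegaRect_one_two_two_mem_collapseExponents : omegaRect F 1 2 2 ∈ collapseExponents F := by
  refine ⟨fun n => padWeight n, IsBigO.of_bound 1 ?_⟩
  filter_upwards [eventually_ge_atTop 2] with n hn
  rw [one_mul, Real.norm_of_nonneg (Real.rpow_nonneg (Nat.cast_nonneg _) _),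
    Real.norm_of_nonneg (Nat.cast_nonneg _)]
  exact rpow_omegaRect_le_tensorRank_kronecker_padWeight F hn

/-- `collapseExponents F` is a lower set (`n^β ≤ n^γ` for `β ≤ γ`, `n ≥ 1`). [folklore] -/
theorem mem_collapseExponents_of_le {β γ : ℝ} (hγ : γ ∈ collapseExponents F) (h : β ≤ γ) :
    β ∈ collapseExponents F := by
  obtain ⟨W, hW⟩ := hγ
  refine ⟨W, IsBigO.trans (IsBigO.of_bound 1 ?_) hW⟩
  filter_upwards [eventually_ge_atTop 1] with n hn
  have hn' : (1 : ℝ) ≤ n := by exact_mod_cast hn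
  rw [one_mul, Real.norm_of_nonneg (Real.rpow_nonneg (Nat.cast_nonneg _) _),
    Real.norm_of_nonneg (Real.rpow_nonneg (Nat.cast_nonneg _) _)]
  exact Real.rpow_le_rpow_of_exponent_le hn' h

/-- **Universality in exponents**: every collapse-certified exponent is `≤ ω(1,2,2)` —
`R(⟨n,n,n⟩ ⊠ W_n) ≤ R(⟨n, n², n²⟩) = R(⟨⌈n¹⌉, ⌈n²⌉, ⌈n²⌉⟩) = O(n^γ)` for every admissible `γ` of format
`(1,2,2)`. [cite: Blaser2013, Lemma 5.4] -/
theorem le_omegaRect_of_mem_collapseExponents {β : ℝ} (hβ : β ∈ collapseExponents F) :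
    β ≤ omegaRect F 1 2 2 := by
  obtain ⟨W, hW⟩ := hβ
  refine le_csInf (rectAdmissibleExponents_nonempty F 1 2 2) fun γ hγ => ?_
  refine rpow_exponent_le_of_isBigO (hW.trans (IsBigO.trans ?_ hγ))
  refine IsBigO.of_bound 1 (Eventually.of_forall fun n => ?_)
  rw [one_mul, Real.norm_of_nonneg (Nat.cast_nonneg _), Real.norm_of_nonneg (Nat.cast_nonneg _)]
  have h2 : rectDim n 2 = n ^ 2 := by
    rw [show (2 : ℝ) = ((2 : ℕ) : ℝ) by norm_num, rectDim_natCast]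
  rw [tensorRank_matMulTensor_congr F (rectDim_one n) h2 h2]
  exact_mod_cast tensorRank_kronecker_le_rect' n (W n)

/-- **THE COLLAPSE WINDOW IS CLOSED** (t1 + universality): `collapseExponents F = (-∞, ω(1,2,2)]`.
[cite: Blaser2013, Lemma 5.4] -/
theorem collapseExponents_eq_Iic : collapseExponents F = Set.Iic (omegaRect F 1 2 2) :=
  Set.ext fun _ => ⟨le_omegaRect_of_mem_collapseExponents F,
    fun h => mem_collapseExponents_of_le F (omegaRect_one_two_two_mem_collapseExponents F) h⟩

/-- The same window with the exponent written `ω(2,1,2)` (as in `TetraExcessZero`).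
[cite: AlmanDuanVassilevskaWilliamsXuXuZhou2025, §3.4] -/
theorem collapseExponents_eq_Iic' : collapseExponents F = Set.Iic (omegaRect F 2 1 2) := by
  rw [collapseExponents_eq_Iic, omegaRect_swap₁₂ F 1 2 2]

/-- Membership test: `β ∈ collapseExponents F ↔ β ≤ ω(2,1,2)`. [folklore] -/
theorem mem_collapseExponents_iff {β : ℝ} : β ∈ collapseExponents F ↔ β ≤ omegaRect F 2 1 2 := by
  rw [collapseExponents_eq_Iic']
  exact Set.mem_Iic

/-- `ω(2,1,2)` is the GREATEST collapse-certified exponent (attained, by the padded identity weight).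
[folklore] -/
theorem isGreatest_collapseExponents : IsGreatest (collapseExponents F) (omegaRect F 2 1 2) := by
  rw [collapseExponents_eq_Iic']
  exact isGreatest_Iic

/-- `sup (collapseExponents F) = ω(2,1,2)`: the free-weight supremum of door D2 in exponents. [folklore] -/
theorem sSup_collapseExponents : sSup (collapseExponents F) = omegaRect F 2 1 2 :=
  (isGreatest_collapseExponents F).csSup_eq

/-! ## §4 Collapse saturation ⟺ `ω + 2 ≤ ω(2,1,2)` ⟺ `ω = 2` -/

/-- **Collapse saturation ⟺ `ω + 2 ≤ ω(2,1,2)`** (the window is `(-∞, ω(2,1,2)]`). [folklore] -/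
theorem collapseSaturation_iff :
    (∀ ε > (0 : ℝ), ∃ β ∈ collapseExponents F, omega F + 2 - ε ≤ β) ↔
      omega F + 2 ≤ omegaRect F 2 1 2 := by
  constructor
  · intro h
    by_contra hlt
    rw [not_le] at hlt
    obtain ⟨β, hβ, hle⟩ := h ((omega F + 2 - omegaRect F 2 1 2) / 2) (by linarith)
    have := (mem_collapseExponents_iff F).1 hβ
    linarith
  · intro h ε hε
    exact ⟨omegaRect F 2 1 2, (mem_collapseExponents_iff F).2 le_rfl, by linarith⟩

/-- **`ω + 2 ≤ ω(2,1,2)` forces `ω = 2`**: the recorded chord `ω(2,1,2) − 4 ≤ κ(0.1722)·(ω − 2)` with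
`κ(0.1722) = (1 − 2·0.1722)/(1 − 0.1722) < 0.792 < 1` (Lotti–Romani: `b ↦ ω(1,b,1)` convex and flat on
`[0, α]`; Coppersmith 1982: `α > 0.1722`) leaves no room for `ω − 2 ≤ ω(2,1,2) − 4` unless `ω = 2`.
[cite: Coppersmith1982, Thm. 1] -/
theorem omega_eq_two_of_omega_add_two_le_omegaRect (h : omega F + 2 ≤ omegaRect F 2 1 2) :
    omega F = 2 := by
  have hc := EdgePencil.rectDefect_le_kappa_mul_defect F (a := 0.1722) (by norm_num) (by norm_num)
    (EdgePencil.coppersmithFloor_le_dualExponentAlpha F)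
  have hκ := EdgePencil.kappa_coppersmithFloor_lt
  have hd := EdgePencil.defect_nonneg F
  have hk : (1 - 2 * (0.1722 : ℝ)) / (1 - 0.1722) * (omega F - 2) ≤ 0.792 * (omega F - 2) :=
    mul_le_mul_of_nonneg_right hκ.le hd
  linarith [omega_two_le F]

/-- Conversely `ω = 2 ⟹ ω + 2 ≤ ω(2,1,2)` (`4 ≤ ω(2,1,2)` by flattening). [cite: HuangPan1998, §2 eq. (2.8)] -/
theorem omega_add_two_le_omegaRect_of_omega_eq_two (h : omega F = 2) :
    omega F + 2 ≤ omegaRect F 2 1 2 := by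
  have := four_le_omegaRect_two_one_two F
  linarith

/-- **`ω + 2 ≤ ω(2,1,2) ⟺ ω = 2`** over every field. [cite: Coppersmith1982, Thm. 1] -/
theorem omega_add_two_le_omegaRect_iff : omega F + 2 ≤ omegaRect F 2 1 2 ↔ omega F = 2 :=
  ⟨omega_eq_two_of_omega_add_two_le_omegaRect F, omega_add_two_le_omegaRect_of_omega_eq_two F⟩

/-- **Collapse saturation ⟺ `ω = 2`** over every field: door D2 is EQUIVALENT to the summit, not an
input beneath the residual. [cite: Coppersmith1982, Thm. 1] -/
theorem collapseSaturation_iff_omega_eq_two :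
    (∀ ε > (0 : ℝ), ∃ β ∈ collapseExponents F, omega F + 2 - ε ≤ β) ↔ omega F = 2 :=
  (collapseSaturation_iff F).trans (omega_add_two_le_omegaRect_iff F)

end Exponent

/-! ## §5 Over `ℂ`: door D2 ⟺ `MatrixMultiplication` (t2 by name), ⟺ the whole cut of record -/

section Complex

open Summit.MatrixMultiplication.MatrixMultiplication.Theses.TetrahedronCarving

/-- **Door D2 is the summit in costume**: collapse saturation over `ℂ` ⟺ `MatrixMultiplication`.
[cite: Coppersmith1982, Thm. 1] -/
theorem collapseSaturation_iff_matrixMultiplication :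
    (∀ ε > (0 : ℝ), ∃ β ∈ collapseExponents ℂ, omega ℂ + 2 - ε ≤ β) ↔ _root_.MatrixMultiplication :=
  (collapseSaturation_iff_omega_eq_two ℂ).trans MatrixMultiplication_iff.symm

/-- **t2 — `S ⟹ h` BY NAME**: `MatrixMultiplication` implies collapse saturation (the hypothesis of
`tetraPlusTwo_of_collapseSaturation`). [cite: Coppersmith1982, Thm. 1] -/
theorem collapseSaturation_of_matrixMultiplication (hS : _root_.MatrixMultiplication) :
    ∀ ε > (0 : ℝ), ∃ β ∈ collapseExponents ℂ, omega ℂ + 2 - ε ≤ β :=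
  collapseSaturation_iff_matrixMultiplication.2 hS

/-- **`h ⟹ S` BY NAME**: collapse saturation over `ℂ` proves the summit outright (so as a route input it
is summit-strength). [cite: Coppersmith1982, Thm. 1] -/
theorem matrixMultiplication_of_collapseSaturation
    (h : ∀ ε > (0 : ℝ), ∃ β ∈ collapseExponents ℂ, omega ℂ + 2 - ε ≤ β) : _root_.MatrixMultiplication :=
  collapseSaturation_iff_matrixMultiplication.1 h

/-- Collapse saturation ⟺ the WHOLE cut of record `TetraExcessZero ∧ TetraPlusTwo` — not the residual
`TetraPlusTwo` alone: the g29 door `h → TetraPlusTwo` is `S → TetraPlusTwo` after `h ↔ S`.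
[cite: Coppersmith1982, Thm. 1] -/
theorem collapseSaturation_iff_excessZero_and_plusTwo :
    (∀ ε > (0 : ℝ), ∃ β ∈ collapseExponents ℂ, omega ℂ + 2 - ε ≤ β) ↔
      TetraExcessZero ∧ TetraPlusTwo :=
  collapseSaturation_iff_matrixMultiplication.trans
    EdgePencil.matrixMultiplication_iff_excessZero_and_plusTwo'

/-- The door, re-derived through the summit: `h → TetraPlusTwo` (= g29's
`tetraPlusTwo_of_collapseSaturation`) as the second conjunct of `h ↔ TetraExcessZero ∧ TetraPlusTwo`;
the FIRST conjunct shows `h` also gives the attacked leaf `TetraExcessZero` (item 26697). [folklore] -/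
theorem excessZero_and_plusTwo_of_collapseSaturation
    (h : ∀ ε > (0 : ℝ), ∃ β ∈ collapseExponents ℂ, omega ℂ + 2 - ε ≤ β) :
    TetraExcessZero ∧ TetraPlusTwo :=
  collapseSaturation_iff_excessZero_and_plusTwo.1 h

end Complex

end Summit.MatrixMultiplication.MatrixMultiplication.Theorems.TetrahedronTensor

end
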